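import Literature.Computability.Cryptography.IndistinguishableFarEnsemblesSampler
import HarnessLib

/-!
# Constructible, indistinguishable, far-apart ensembles give one-way functions, III: the hashed candidate `F = g f̃`

Third file of the discharge of `Goldreich2001_owfExist_of_indistinguishable_farApart` (Goldreich 2001, §3.8
Exercise 11). The candidate weak one-way function is Impagliazzo–Luby's hashed function of Goldreich's
Ch. 2, Exercise 17 — `F(x, i, h) = (f(x), h_i(x), i, h)` — applied to the two-sampler function `f̃` of
`IndistinguishableFarEnsemblesSampler.lean`, in the concrete format `HILL.g` already in the tree
(`HILLHashedFunction.lean`: `g f (x ‖ ι ‖ r) = f(x) ‖ maskTo(h_r(x)) ‖ ι ‖ r`, affine hashing keyed by `r`,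
the prefix length `⟦ι⟧ + eLen N` zero-padded to `hLen N`). This file supplies what the reduction needs about
`HILL.g f` for a length-preserving `f` at EVERY input length (HILL's own file only uses the seed lengths
`N + rlen N`):

* `HILL.g_eq_of_lvl`, `HILL.length_g_eq` — the value and the output length `|g f v| = |v| + hLen (lvl |v|)`;
  `HILL.sl_lvl_le`, `HILL.lt_sl_lvl_succ`, `HILL.lvl_mono`, monotonicity of `hLen`, and
  `HILL.strictMono_outLen`: the output length is strictly increasing in the input length, so
  **`g f w = g f v` forces `|w| = |v|`** (`HILL.length_eq_of_g_eq`) and then all four blocks agree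
  (`HILL.g_eq_g_iff`: same `f`-value, same masked hash, same index block, same key);
* `FarApartOWF.Params.F = HILL.g P.ftil` and its polynomial-time program `FProg2.FF` (the level by the clocked
  search `FProg.searchF (X + R0)`, then HILL's program `G2` generalised to keys longer than `rlen N`,
  `G2_apply_of_lvl`), `F_polyTime`.

## References

* O. Goldreich, *Foundations of Cryptography I*, CUP 2001, Ch. 2 Exercise 17 (guideline: `F(x,i,h)`), §3.8
  Exercise 11.
* R. Impagliazzo, M. Luby, FOCS 1989 (distributionally one-way functions).
* J. Håstad, R. Impagliazzo, L. Levin, M. Luby, SIAM J. Comput. 28 (1999), §6.1 eq. (3) (the format `f'`).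
-/

namespace Literature.Computability.Cryptography

open Filter Finset Polynomial _root_.Computability Complexity AffineStr

noncomputable section

namespace HILL

/-! ### `g f` at every input length -/

/-- The seed length of level `N`: `sl N = N + rlen N`. [folklore] -/
def sl (N : ℕ) : ℕ := N + rlen N

/-- `sl` is strictly increasing. [folklore] -/
theorem sl_strictMono : StrictMono sl := strictMono_seedLen

/-- `sl 0 = 6`. [folklore] -/
@[simp] theorem sl_zero : sl 0 = 6 := by simp [sl, rlen]

/-- Specification of the level: `sl (lvl m) ≤ m` once `6 ≤ m`. [folklore] -/
theorem sl_lvl_le {m : ℕ} (hm : 6 ≤ m) : sl (lvl m) ≤ m :=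
  Nat.findGreatest_spec (P := fun N => N + rlen N ≤ m) (Nat.zero_le m) (by simpa [rlen] using hm)

/-- `lvl m ≤ m`. [folklore] -/
theorem lvl_le (m : ℕ) : lvl m ≤ m := Nat.findGreatest_le m

/-- Specification of the level: `m < sl (lvl m + 1)`. [folklore] -/
theorem lt_sl_lvl_succ (m : ℕ) : m < sl (lvl m + 1) := by
  by_contra h
  push Not at h
  have hle : lvl m + 1 ≤ m := le_trans (Nat.le_add_right _ _) h
  have := Nat.le_findGreatest (P := fun N => N + rlen N ≤ m) hle h
  unfold lvl at this
  omega

/-- The level of a length in the window of `N`. [folklore] -/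
theorem lvl_eq_of_mem {N m : ℕ} (h1 : sl N ≤ m) (h2 : m < sl (N + 1)) : lvl m = N := by
  have ha : sl (lvl m) ≤ m := sl_lvl_le (le_trans (by simpa using sl_strictMono.monotone (Nat.zero_le N)) h1)
  have hb := lt_sl_lvl_succ m
  have h3 : lvl m < N + 1 := sl_strictMono.lt_iff_lt.1 (ha.trans_lt h2)
  have h4 : N < lvl m + 1 := sl_strictMono.lt_iff_lt.1 (h1.trans_lt hb)
  omega

/-- `lvl` is monotone. [folklore] -/
theorem lvl_mono : Monotone lvl := fun _ _ hab => Nat.findGreatest_mono (fun N (h : N + rlen N ≤ _) => h.trans hab) hab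

/-- `lvl m → ∞`. [folklore] -/
theorem tendsto_lvl : Tendsto lvl atTop atTop := by
  refine tendsto_atTop_atTop.2 fun N => ⟨sl N, fun m hm => ?_⟩
  by_contra h
  push Not at h
  have hb := lt_sl_lvl_succ m
  have : sl (lvl m + 1) ≤ sl N := sl_strictMono.monotone (by omega)
  omega

/-- `bLen` is monotone. [folklore] -/
theorem bLen_mono : Monotone bLen := fun _ _ h => Nat.succ_le_succ (Nat.log_mono_right h)

/-- `bLen (N+1) ≤ bLen N + 1`. [folklore] -/
theorem bLen_succ_le (N : ℕ) : bLen (N + 1) ≤ bLen N + 1 := by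
  unfold bLen
  have h : Nat.log 2 (N + 1) ≤ Nat.log 2 N + 1 := by
    rcases Nat.eq_zero_or_pos N with rfl | hN
    · simp
    · calc Nat.log 2 (N + 1) ≤ Nat.log 2 (2 * N) := Nat.log_mono_right (by omega)
        _ = Nat.log 2 N + 1 := by rw [mul_comm, Nat.log_mul_base (by norm_num) hN.ne']
  omega

/-- `nLen` is monotone. [folklore] -/
theorem nLen_mono : Monotone nLen := by
  refine monotone_nat_of_le_succ fun N => ?_
  have := bLen_succ_le N
  unfold nLen; omega

/-- `hLen` is monotone. [folklore] -/
theorem hLen_mono : Monotone hLen := fun a b h => by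
  unfold hLen eLen
  have h1 := nLen_mono h
  have h2 := bLen_mono h
  omega

/-- **The output length `m ↦ m + hLen (lvl m)` is strictly increasing.** [folklore] -/
theorem strictMono_outLen : StrictMono fun m => m + hLen (lvl m) :=
  fun _ _ h => Nat.add_lt_add_of_lt_of_le h (hLen_mono (lvl_mono h.le))

variable {f : List Bool → List Bool}

/-- **Value of `g` at every length**: with `N = lvl |v|`, `w = v ↾ N`, `ρ = v ⇂ N` (a key of length `|v| − N ≥ rlen N`),
`g f v = body N (f (xOf w)) (iBits w) (h_ρ(xOf w)) ρ`. [cite: HastadImpagliazzoLevinLuby1999, §6.1 eq. (3)] -/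
theorem g_eq_of_lvl {N : ℕ} {v : List Bool} (h : lvl v.length = N) :
    g f v = body N (f (xOf (v.take N))) (iBits (v.take N)) (hashStr (nLen N) (hLen N) (v.drop N) (xOf (v.take N))) (v.drop N) := by
  simp only [g, h]

/-- **Output length of `g`** for a length-preserving `f`, at every length: `|g f v| = |v| + hLen (lvl |v|)`. [folklore] -/
theorem length_g_eq (hlp : IsLengthPreserving f) (v : List Bool) : (g f v).length = v.length + hLen (lvl v.length) := by
  set N := lvl v.length with hN
  have hNle : N ≤ v.length := lvl_le _
  rw [g_eq_of_lvl hN.symm, length_body _ _ _ (length_hashStr ..), hlp, length_xOf, length_iBits, List.length_take,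
    min_eq_left hNle, List.length_drop]
  have := nLen_add_ibLen N
  omega

/-- **Equal images have equal lengths.** [folklore] -/
theorem length_eq_of_g_eq (hlp : IsLengthPreserving f) {v w : List Bool} (h : g f w = g f v) : w.length = v.length := by
  have h1 := congrArg List.length h
  rw [length_g_eq hlp, length_g_eq hlp] at h1
  exact strictMono_outLen.injective h1

/-- **Reading an image of `g`.** For `w, v` of the same length and `N` its level: `g f w = g f v` iff the
`f`-values, the masked hashes, the index blocks and the keys agree. [folklore] -/
theorem g_eq_g_iff (hlp : IsLengthPreserving f) {N : ℕ} {v w : List Bool} (hv : lvl v.length = N) (hlen : w.length = v.length) :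
    g f w = g f v ↔
      f (xOf (w.take N)) = f (xOf (v.take N)) ∧
      maskTo N (icap N (iBits (w.take N))) (hashStr (nLen N) (hLen N) (w.drop N) (xOf (w.take N))) =
        maskTo N (icap N (iBits (v.take N))) (hashStr (nLen N) (hLen N) (v.drop N) (xOf (v.take N))) ∧
      iBits (w.take N) = iBits (v.take N) ∧ w.drop N = v.drop N := by
  have hw : lvl w.length = N := by rw [hlen]; exact hv
  have htk : (w.take N).length = (v.take N).length := by rw [List.length_take, List.length_take, hlen]
  have hf : (f (xOf (w.take N))).length = (f (xOf (v.take N))).length := by rw [hlp, hlp, length_xOf, length_xOf, htk]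
  have hm : (maskTo N (icap N (iBits (w.take N))) (hashStr (nLen N) (hLen N) (w.drop N) (xOf (w.take N)))).length =
      (maskTo N (icap N (iBits (v.take N))) (hashStr (nLen N) (hLen N) (v.drop N) (xOf (v.take N)))).length := by
    rw [length_maskTo (length_hashStr ..), length_maskTo (length_hashStr ..)]
  have hib : (iBits (w.take N)).length = (iBits (v.take N)).length := by rw [length_iBits, length_iBits, htk]
  rw [g_eq_of_lvl hw, g_eq_of_lvl hv, body, body]
  constructor
  · intro h
    rw [List.append_assoc, List.append_assoc, List.append_assoc, List.append_assoc] at h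
    obtain ⟨h1, h⟩ := List.append_inj h hf
    obtain ⟨h2, h⟩ := List.append_inj h hm
    obtain ⟨h3, h4⟩ := List.append_inj h hib
    exact ⟨h1, h2, h3, h4⟩
  · rintro ⟨h1, h2, h3, h4⟩
    rw [h1, h2, h3, h4]

/-- Two strings with the same first `k` bits have the same mask at every level `i` with `i + eLen N ≤ k`
(`maskTo` only reads a prefix). [folklore] -/
theorem maskTo_eq_of_take_eq' {N i k : ℕ} {h h' : List Bool} (hk : i + eLen N ≤ k) (h1 : h.take k = h'.take k) :
    maskTo N i h = maskTo N i h' := by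
  apply maskTo_eq_of_take_eq
  have := congrArg (List.take (i + eLen N)) h1
  rwa [List.take_take, List.take_take, min_eq_left hk] at this

/-- Conversely equal masks give equal prefixes of length `i + eLen N` (for hash values of length `hLen N`).
[folklore] -/
theorem take_eq_of_maskTo_eq {N i : ℕ} {h h' : List Bool} (hh : h.length = hLen N) (hh' : h'.length = hLen N)
    (hm : maskTo N i h = maskTo N i h') : h.take (i + eLen N) = h'.take (i + eLen N) := by
  unfold maskTo at hm
  have hl : (h.take (i + eLen N)).length = (h'.take (i + eLen N)).length := by
    rw [List.length_take, List.length_take, hh, hh']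
  exact (List.append_inj hm hl).1

end HILL

namespace FarApartOWF

namespace Params

variable (P : Params)

/-- **The candidate weak one-way function** `F = g f̃`: Impagliazzo–Luby's hashed function of the two-sampler
map. [cite: Goldreich2001, Ch. 2 Exercise 17 (guideline: `F(x,i,h) = (f(x), h_i(x), i, h)`) with §3.8 Exercise 11] -/
def F : List Bool → List Bool := HILL.g P.ftil

/-- `|F v| = |v| + hLen (lvl |v|)`. [folklore] -/
theorem length_F (v : List Bool) : (P.F v).length = v.length + HILL.hLen (HILL.lvl v.length) :=
  HILL.length_g_eq P.isLengthPreserving_ftil v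

/-- `F w = F v` forces `|w| = |v|`. [folklore] -/
theorem length_eq_of_F_eq {v w : List Bool} (h : P.F w = P.F v) : w.length = v.length :=
  HILL.length_eq_of_g_eq P.isLengthPreserving_ftil h

end Params

/-! ### The program for `F` -/

namespace FProg2

open Complexity.Brick Complexity.Plumb Complexity.OracleCompose HILL

variable (P : Params)

/-- `1^{lvl |v|}` by the clocked search for the predicate `N + rlen N ≤ |v|`. [folklore] -/
def lvlF : List Bool → List Bool := FProg.searchF (X + R0)

/-- Value of `lvlF`. [folklore] -/
@[simp] theorem lvlF_apply (v : List Bool) : lvlF v = ones (lvl v.length) := by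
  rw [lvlF, FProg.searchF_apply]
  unfold FProg.maxBelow lvl
  simp only [eval_add, eval_X, R0_eval]

/-- **The program for `F`**: HILL's `G2` on `⟨1^{lvl |v|}, v⟩`. [folklore] -/
def FF : List Bool → List Bool := G2 P.ftil ∘ fanoutFn lvlF id

variable {P}

/-- `|1ⁿ| = n`. [folklore] -/
private theorem length_unaryEncodeNat' (n : ℕ) : (unaryEncodeNat n).length = n := unary_decode_encode_nat n

/-- **`G2` computes `g` at every length**: `G2 ⟨1^N, v⟩ = g f v` whenever `lvl |v| = N` (HILL's `G2_apply` is the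
case `|v| = N + rlen N`; the program never used that the key has length exactly `rlen N`). [folklore] -/
theorem G2_apply_of_lvl (f : List Bool → List Bool) {N : ℕ} {v : List Bool} (hv : lvl v.length = N) :
    G2 f (boolPair (unaryEncodeNat N) v) = g f v := by
  have hNle : N ≤ v.length := hv ▸ lvl_le _
  set w := v.take N with hwdef
  set ρ := v.drop N with hρdef
  have hw : w.length = N := by rw [hwdef, List.length_take, min_eq_left hNle]
  have hvw : v = w ++ ρ := (List.take_append_drop N v).symm
  set z := boolPair (unaryEncodeNat N) v with hz
  have hN := length_unaryEncodeNat' N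
  have hu : uF z = unaryEncodeNat N := uF_pair N _
  have hn : nU z = ones (nLen N) := nU_pair N _
  have he : eU z = ones (eLen N) := eU_pair N _
  have hh : hU z = ones (hLen N) := hU_pair N _
  have hwF : wF z = w := by
    rw [wF, Function.comp_apply, fanoutFn_apply, hu, hz, sndF_boolPair, takeFn_boolPair, hN]
  have hrF : rF z = ρ := by
    rw [rF, Function.comp_apply, fanoutFn_apply, hu, hz, sndF_boolPair, dropFn_boolPair, hN]
  have hxF : xF z = xOf w := by
    rw [xF, Function.comp_apply, fanoutFn_apply, hn, hwF, takeFn_boolPair, xOf, hw]; simp [ones]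
  have hib : ibF z = iBits w := by
    rw [ibF, Function.comp_apply, fanoutFn_apply, hn, hwF, dropFn_boolPair, iBits, hw]; simp [ones]
  have hhash : hashF z = hashStr (nLen N) (hLen N) ρ (xOf w) := by
    rw [hashF, Function.comp_apply, fanoutFn_apply, fanoutFn_apply, fanoutFn_apply, hn, hh, hrF, hxF, AffineProg.hashFn_boolPair]
  have hi : iU z = ones (icap N (iBits w)) := by
    rw [iU, Function.comp_apply, fanoutFn_apply, Function.comp_apply, fanoutFn_apply, Function.comp_apply, fanoutFn_apply, hu, hib,
      concatFn_boolPair, concatFn_boolPair, binToUnaryFn_boolPair, icap]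
    simp only [List.length_append, hN, ones, List.length_replicate, two_mul]
  have ht : tU z = ones (icap N (iBits w) + eLen N) := by
    rw [tU, Function.comp_apply, fanoutFn_apply, hi, he, concatFn_boolPair, Com.ones_append]
  have hmask : maskF z = maskTo N (icap N (iBits w)) (hashStr (nLen N) (hLen N) ρ (xOf w)) := by
    rw [maskF, Function.comp_apply, fanoutFn_apply, Function.comp_apply, fanoutFn_apply, ht, hhash, takeFn_boolPair,
      Function.comp_apply, Function.comp_apply, fanoutFn_apply, ht, hh, dropFn_boolPair, Kannan.zerosFn_apply, concatFn_boolPair,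
      maskTo]
    simp [ones]
  rw [G2, Function.comp_apply, fanoutFn_apply, Function.comp_apply, fanoutFn_apply, Function.comp_apply, fanoutFn_apply,
    Function.comp_apply, hxF, hmask, hib, hrF, concatFn_boolPair, concatFn_boolPair, concatFn_boolPair, g_eq_of_lvl hv, HILL.body]

/-- **The program computes `F`.** [folklore] -/
theorem FF_apply (v : List Bool) : FF P v = P.F v := by
  rw [FF, Function.comp_apply, fanoutFn_apply, lvlF_apply, id, Params.F]
  rw [show ones (lvl v.length) = unaryEncodeNat (lvl v.length) by simp [ones, Complexity.unaryEncodeNat_eq_replicate]]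
  exact G2_apply_of_lvl _ rfl

/-- **`F` is polynomial-time computable** for polynomial-time samplers. [cite: Goldreich2001, Ch. 2 Exercise 17 (guideline: `F` is polynomial-time)] -/
theorem F_polyTime (h0 : P.S0.IsPolyTime unaryEncodeNat id) (h1 : P.S1.IsPolyTime unaryEncodeNat id) :
    PolyTimeComputable id id P.F := by
  have hft : P.ftil ∈ FP := FProg.ftil_polyTime h0 h1
  have h : P.F = FF P := funext fun v => (FF_apply v).symm
  rw [h]
  exact comp_mem_FP (G2_mem_FP hft) (fanoutFn_mem_FP (FProg.searchF_mem_FP _) OracleCompose.id_mem_FP)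

end FProg2

end FarApartOWF

end

end Literature.Computability.Cryptography
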